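import Literature.NumberTheory.Automorphic.UnitaryGroupArchSection
import HarnessLib

/-!
# `K`-type subgroups of `U(J)(𝔸_F)` away from one infinite place: commutation with the section,
  rational splitting at finite level, uniqueness of the corrector, and the one-place obstruction

Registry: pub-hodgecm MODEL-CONSTRUCTION sub-cell, unitary-group lane (lineage mc-unitary-2, gen 6), MODEL-DAG
node **(W-Kf″)-L2**: the GROUP-SIDE half (`K₂`, `κ₂`, `comm`, `level`) of the archimedean `K`-type datum at the
honest archimedean side (`ιinf` = the section at ONE complex place, `UnitaryGroupArchSection`). Proved lemmas
(kernel) plus transparent definitions; no named facts, no proof placeholders; imports = Mathlib + tree.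

Setting: a CM-type pair `(F, E, c)` (`c ≠ 1` fixing every infinite place of `E`), a form `J ∈ M_N(E)`, the unitary
group `U(J)` with `U(J)(𝔸_F) = U(J)(E ⊗ ℝ) · U(J)(𝔸_{F,f})` (`UnitaryGroupAdelicProduct`), `U(J)(E ⊗ ℝ) ≃ Π_w U(σ_w J)(ℂ)`
over the complex places `w` of `E` (`UnitaryGroupArchimedeanPlaces`), the section `adelicSingle w₁ : U(σ_{w₁} J)(ℂ) →*
U(J)(𝔸_F)` at one complex place `w₁` and the subgroup `awayFrom w₁ = Π_{w ≠ w₁} U(σ_w J)(ℂ) × U(J)(𝔸_{F,f})` of elements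
with trivial `w₁`-component (`UnitaryGroupArchSection`), a subgroup ("finite level") `K_f ≤ U(J)(𝔸_{F,f})` and its
arithmetic subgroup `Γ(K_f) = U(J)(F) ∩ K_f` (`UnitaryGroupArithmeticLevels`).

* § 1 (generic, one complex place `w₁`). Components of a corrector: if `g = adelicSingle w₁ u · k` then `k_f = g_f`
  and `(k_∞)_w = (g_∞)_w` for `w ≠ w₁` (`finPart_eq_of_adelicSingle_mul_eq`, `archAt_archPart_eq_of_adelicSingle_mul_eq`),
  and for `k ∈ awayFrom w₁` the pair `(u, k)` is UNIQUE (`eq_of_adelicSingle_mul_eq_adelicSingle_mul`). The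
  **`K`-type subgroup away from `w₁` at finite level `K_f`**, `awayLevel w₁ K_f = awayFrom w₁ ⊓ finPart⁻¹ K_f =
  Π_{w ≠ w₁} U(σ_w J)(ℂ) × K_f`: its elements commute with every `adelicSingle w₁ u`
  (`commute_adelicSingle_of_mem_awayLevel`); **rational splitting at level `K_f`**: for `γ ∈ U(J)(F)` with `γ_f ∈ K_f`
  (equivalently `γ ∈ Γ(K_f)`), `γ = adelicSingle w₁ (σ_{w₁} γ) · k` with `k ∈ awayLevel w₁ K_f`
  (`exists_toAdelic_eq_adelicSingle_mul_mem_awayLevel`, `…_of_mem_arithmeticLevel`). The **special** variant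
  `specialAwayLevel w₁ K_f = awayLevel w₁ K_f ∩ ⋂_w ker (det ∘ ( · )_w)` (determinant-one archimedean components) and
  the rational splitting into it for `det γ = 1` (`exists_toAdelic_eq_adelicSingle_mul_mem_specialAwayLevel`).
  **The one-place obstruction**: if `adelicSingle w₁ u · k = γ` is rational and `k` has trivial component at some
  complex place `w₂ ≠ w₁`, then `γ = 1` (`eq_one_of_adelicSingle_mul_eq_toAdelic`; `σ_{w₂}` is injective on `U(J)(F)`),
  hence `u = 1`, `k = 1` when moreover `k ∈ awayFrom w₁`; in particular a corrector `k` in the finite-adelic factor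
  `U(J)(𝔸_{F,f})` (`finiteAdelic = ker archPart`) forces `γ = u = k = 1` as soon as `E` has two complex places
  (`2 < [E : ℚ]` for `E` totally complex, `exists_ne_of_two_lt_finrank`).
* § 2 (`N = 3`, at a complex embedding `τ` through a frame `T`, and the CM case typed on `↥(adelicUnitaryGroup L H)` /
  `adelicUnitaryRat L H` / `BallRational.toBall`): `awayLevelCM`, `specialAwayLevelCM`, commutation with
  `archSectionU21CM` (`commute_archSectionU21CM_of_mem_awayLevelCM`), **`∀ g ∈ Γ(K_f), ∃ k ∈ awayLevelCM K_f,
  archSectionU21CM (toBall g) · k ∈ U(H)(L⁺)`** (`exists_archSectionU21CM_mul_mem_adelicUnitaryRat_of_mem_arithmeticLevel`,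
  special variant under `det g = 1`), and the CM obstruction: **if `archSectionU21CM δ · k ∈ U(H)(L⁺)` with `k_∞ = 1` and
  `2 < [L : ℚ]`, then `δ = 1` and `k = 1`** (`eq_one_of_archSectionU21CM_mul_mem_adelicUnitaryRat`) — so a `K`-type
  group inside the finite-adelic factor can absorb NO non-trivial rational point along the one-place section.

References (provenance of the constructions; nothing enters as a hypothesis): A. Borel, H. Jacquet, *Automorphic
forms and automorphic representations*, Proc. Symp. Pure Math. 33.1 (1979), §4.1 (`G(𝔸) = G_∞ × G(𝔸_f)`,
`G_∞ = ∏_{v ∣ ∞} G(F_v)`, `K = K_∞ × K_f`); V. Platonov, A. Rapinchuk, *Algebraic Groups and Number Theory* (1994),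
§5.1 (adele groups, `G_𝔸 = G_∞ × G_{𝔸_f}`, the diagonal embedding of `G_F`).
-/

noncomputable section

open NumberField NumberField.InfinitePlace Topology IsDedekindDomain

open scoped Matrix MatrixGroups ComplexConjugate ComplexOrder

namespace Literature.NumberTheory.Automorphic

namespace UnitaryGroup

open NumberField.mixedEmbedding Literature.Geometry.ComplexHyperbolic Literature.Geometry.ComplexHyperbolic.BallModel
open Literature.AlgebraicGeometry.ShimuraVarieties

variable (F E : Type) [Field F] [NumberField F] [Field E] [NumberField E] [Algebra F E]
  (c : E ≃ₐ[F] E) (N : ℕ) (J : Matrix (Fin N) (Fin N) E)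

/-! ## 1. One complex place `w₁`: correctors, `awayLevel w₁ K_f`, rational splitting, the obstruction -/

section Single

variable (hc : c ≠ 1) (hfix : ∀ w : InfinitePlace E, c • w = w) (w₁ : {w : InfinitePlace E // IsComplex w})

/-! ### 1a. Injectivity of `σ_w` on rational points; a second complex place -/

omit [NumberField F] [NumberField E] in
/-- **`σ_w : U(J)(F) →* U(σ_w J)(ℂ)` is injective** (a field embedding `E →+* ℂ` is injective). [folklore] -/
theorem rationalToArchLocal_injective (w : {w : InfinitePlace E // IsComplex w}) (hw : c • w.1 = w.1) :
    Function.Injective (rationalToArchLocal F E c N J w hw hc) := by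
  intro a b h
  have h' := congrArg (fun u : archLocal E N J w => ((u : GL (Fin N) ℂ) : Matrix (Fin N) (Fin N) ℂ)) h
  simp only [coe_rationalToArchLocal] at h'
  refine Subtype.ext (Matrix.GeneralLinearGroup.ext fun i j => w.1.embedding.injective ?_)
  have hij := congrFun (congrFun h' i) j
  simpa only [Matrix.GeneralLinearGroup.map_apply] using hij

omit [NumberField F] [Algebra F E] in
open Classical in
/-- A totally complex field of degree `> 2` has, besides any given complex place `w₁`, a second complex place
`w₂ ≠ w₁` (`[E : ℚ] = 2 · #{complex places}`). [folklore] -/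
theorem exists_ne_of_two_lt_finrank [IsTotallyComplex E] (h : 2 < Module.finrank ℚ E)
    (w₁ : {w : InfinitePlace E // IsComplex w}) : ∃ w₂ : {w : InfinitePlace E // IsComplex w}, w₂ ≠ w₁ := by
  have hr : Module.finrank ℚ E = 2 * Fintype.card {w : InfinitePlace E // IsComplex w} :=
    IsTotallyComplex.finrank (K := E)
  exact Fintype.exists_ne_of_one_lt_card (by omega) w₁

/-! ### 1b. Components of a corrector; uniqueness -/

/-- If `g = adelicSingle w₁ u · k` then `k_f = g_f` (`(adelicSingle w₁ u)_f = 1`). [folklore] -/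
theorem finPart_eq_of_adelicSingle_mul_eq {u : archLocal E N J w₁} {k g : (adelicGroupData F E c N J).Adelic}
    (h : adelicSingle F E c N J hc hfix w₁ u * k = g) : finPart F E c N J k = finPart F E c N J g := by
  rw [← h, map_mul, finPart_adelicSingle, one_mul]

/-- If `g = adelicSingle w₁ u · k` then `(k_∞)_w = (g_∞)_w` at every complex place `w ≠ w₁`
(`(adelicSingle w₁ u)_w = 1`). [folklore] -/
theorem archAt_archPart_eq_of_adelicSingle_mul_eq {w : {w : InfinitePlace E // IsComplex w}} (hw : w ≠ w₁)
    {u : archLocal E N J w₁} {k g : (adelicGroupData F E c N J).Adelic}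
    (h : adelicSingle F E c N J hc hfix w₁ u * k = g) :
    archAt F E c N J w (hfix w.1) hc (archPart F E c N J k) = archAt F E c N J w (hfix w.1) hc (archPart F E c N J g) := by
  rw [← h, map_mul, map_mul, archPart_adelicSingle, archAt_archSingle_of_ne F E c N J hc hfix w₁ hw, one_mul]

/-- If `g = adelicSingle w₁ u · k` with `k ∈ awayFrom w₁` then `u = (g_∞)_{w₁}`. [folklore] -/
theorem eq_archAt_archPart_of_adelicSingle_mul_eq {u : archLocal E N J w₁} {k g : (adelicGroupData F E c N J).Adelic}
    (hk : k ∈ awayFrom F E c N J hc hfix w₁) (h : adelicSingle F E c N J hc hfix w₁ u * k = g) :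
    u = archAt F E c N J w₁ (hfix w₁.1) hc (archPart F E c N J g) := by
  rw [← h, map_mul, map_mul, archAt_archPart_adelicSingle, (mem_awayFrom_iff F E c N J hc hfix w₁ k).1 hk, mul_one]

/-- **Uniqueness of the splitting**: `adelicSingle w₁ u · k = adelicSingle w₁ u' · k'` with `k, k' ∈ awayFrom w₁`
forces `u = u'` and `k = k'`. [folklore] -/
theorem eq_of_adelicSingle_mul_eq_adelicSingle_mul {u u' : archLocal E N J w₁}
    {k k' : (adelicGroupData F E c N J).Adelic} (hk : k ∈ awayFrom F E c N J hc hfix w₁)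
    (hk' : k' ∈ awayFrom F E c N J hc hfix w₁)
    (h : adelicSingle F E c N J hc hfix w₁ u * k = adelicSingle F E c N J hc hfix w₁ u' * k') : u = u' ∧ k = k' := by
  have hu : u = u' := by
    rw [eq_archAt_archPart_of_adelicSingle_mul_eq F E c N J hc hfix w₁ hk h,
      ← eq_archAt_archPart_of_adelicSingle_mul_eq F E c N J hc hfix w₁ hk' rfl]
  refine ⟨hu, ?_⟩
  rw [hu] at h
  exact mul_left_cancel h

/-! ### 1c. The `K`-type subgroup away from `w₁` at a finite level -/

variable (Kf : Subgroup (finAdelic F E c N J))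

/-- **The `K`-type subgroup of `U(J)(𝔸_F)` away from `w₁` at finite level `K_f`**:
`awayLevel w₁ K_f = {k | (k_∞)_{w₁} = 1, k_f ∈ K_f} = Π_{w ≠ w₁} U(σ_w J)(ℂ) × K_f` (Borel–Jacquet's `K = K_∞ · K_f` with the
factor at `w₁` removed and full factors at the other infinite places). [cite: BorelJacquet1979, §4.1] -/
def awayLevel : Subgroup (adelicGroupData F E c N J).Adelic :=
  awayFrom F E c N J hc hfix w₁ ⊓ Kf.comap (finPart F E c N J)

/-- `k ∈ awayLevel w₁ K_f ↔ k ∈ awayFrom w₁ ∧ k_f ∈ K_f`. [folklore] -/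
theorem mem_awayLevel_iff (k : (adelicGroupData F E c N J).Adelic) :
    k ∈ awayLevel F E c N J hc hfix w₁ Kf ↔ k ∈ awayFrom F E c N J hc hfix w₁ ∧ finPart F E c N J k ∈ Kf :=
  Iff.rfl

/-- `k ∈ awayLevel w₁ K_f ↔ (k_∞)_{w₁} = 1 ∧ k_f ∈ K_f`. [folklore] -/
theorem mem_awayLevel_iff' (k : (adelicGroupData F E c N J).Adelic) :
    k ∈ awayLevel F E c N J hc hfix w₁ Kf ↔
      archAt F E c N J w₁ (hfix w₁.1) hc (archPart F E c N J k) = 1 ∧ finPart F E c N J k ∈ Kf := by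
  rw [mem_awayLevel_iff, mem_awayFrom_iff]

/-- `awayLevel w₁ K_f ≤ awayFrom w₁`. [folklore] -/
theorem awayLevel_le_awayFrom : awayLevel F E c N J hc hfix w₁ Kf ≤ awayFrom F E c N J hc hfix w₁ := inf_le_left

/-- `awayLevel w₁` is monotone in the finite level. [folklore] -/
theorem awayLevel_mono {Kf Kf' : Subgroup (finAdelic F E c N J)} (h : Kf ≤ Kf') :
    awayLevel F E c N J hc hfix w₁ Kf ≤ awayLevel F E c N J hc hfix w₁ Kf' :=
  inf_le_inf_left _ (Subgroup.comap_mono h)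

/-- At full finite level, `awayLevel w₁ ⊤ = awayFrom w₁`. [folklore] -/
@[simp] theorem awayLevel_top : awayLevel F E c N J hc hfix w₁ ⊤ = awayFrom F E c N J hc hfix w₁ := by
  rw [awayLevel, Subgroup.comap_top, inf_top_eq]

/-- The finite-adelic factor meets `awayLevel w₁ K_f` in `K_f`: `(1, b) ∈ awayLevel w₁ K_f ↔ b ∈ K_f`. [folklore] -/
theorem finAdelicToAdelic_mem_awayLevel_iff (b : finAdelic F E c N J) :
    finAdelicToAdelic F E c N J b ∈ awayLevel F E c N J hc hfix w₁ Kf ↔ b ∈ Kf := by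
  rw [mem_awayLevel_iff, finPart_finAdelicToAdelic, and_iff_right (finAdelicToAdelic_mem_awayFrom F E c N J hc hfix w₁ b)]

/-- The full archimedean factors at the other places lie in `awayLevel w₁ K_f`: `adelicSingle w u ∈ awayLevel w₁ K_f` for
`w ≠ w₁` (its finite part is `1 ∈ K_f`). [folklore] -/
theorem adelicSingle_mem_awayLevel_of_ne {w : {w : InfinitePlace E // IsComplex w}} (h : w₁ ≠ w) (u : archLocal E N J w) :
    adelicSingle F E c N J hc hfix w u ∈ awayLevel F E c N J hc hfix w₁ Kf := by
  refine (mem_awayLevel_iff F E c N J hc hfix w₁ Kf _).2 ⟨adelicSingle_mem_awayFrom_of_ne F E c N J hc hfix w₁ h u, ?_⟩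
  rw [finPart_adelicSingle]
  exact one_mem Kf

/-- **Elements of `awayLevel w₁ K_f` commute with the `w₁`-factor** (`commute_adelicSingle_of_mem_awayFrom`).
[cite: BorelJacquet1979, §4.1] -/
theorem commute_adelicSingle_of_mem_awayLevel (u : archLocal E N J w₁) {k : (adelicGroupData F E c N J).Adelic}
    (hk : k ∈ awayLevel F E c N J hc hfix w₁ Kf) : Commute k (adelicSingle F E c N J hc hfix w₁ u) :=
  commute_adelicSingle_of_mem_awayFrom F E c N J hc hfix w₁ u hk.1

/-- **Splitting at level `K_f`**: `g = adelicSingle w₁ ((g_∞)_{w₁}) · k` with `k ∈ awayLevel w₁ K_f` whenever `g_f ∈ K_f`.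
[cite: BorelJacquet1979, §4.1] -/
theorem exists_eq_adelicSingle_mul_mem_awayLevel {g : (adelicGroupData F E c N J).Adelic}
    (hg : finPart F E c N J g ∈ Kf) :
    ∃ k ∈ awayLevel F E c N J hc hfix w₁ Kf,
      g = adelicSingle F E c N J hc hfix w₁ (archAt F E c N J w₁ (hfix w₁.1) hc (archPart F E c N J g)) * k := by
  obtain ⟨k, hk, h⟩ := exists_eq_adelicSingle_mul F E c N J hc hfix w₁ g
  refine ⟨k, (mem_awayLevel_iff F E c N J hc hfix w₁ Kf k).2 ⟨hk, ?_⟩, h⟩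
  rw [finPart_eq_of_adelicSingle_mul_eq F E c N J hc hfix w₁ h.symm]
  exact hg

/-- **Rational splitting at level `K_f`**: for `γ ∈ U(J)(F)` with `γ_f ∈ K_f`, `γ = adelicSingle w₁ (σ_{w₁} γ) · k` with
`k ∈ awayLevel w₁ K_f` — the components of `γ` away from `w₁` are absorbed in the `K`-type group.
[cite: BorelJacquet1979, §4.1] -/
theorem exists_toAdelic_eq_adelicSingle_mul_mem_awayLevel {γ : rational F E c N J}
    (hγ : rationalToFinAdelic F E c N J γ ∈ Kf) :
    ∃ k ∈ awayLevel F E c N J hc hfix w₁ Kf,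
      toAdelic F E c N J γ = adelicSingle F E c N J hc hfix w₁ (rationalToArchLocal F E c N J w₁ (hfix w₁.1) hc γ) * k := by
  obtain ⟨k, hk, h⟩ := exists_toAdelic_eq_adelicSingle_mul F E c N J hc hfix w₁ γ
  refine ⟨k, (mem_awayLevel_iff F E c N J hc hfix w₁ Kf k).2 ⟨hk, ?_⟩, h⟩
  rw [finPart_eq_of_adelicSingle_mul_eq F E c N J hc hfix w₁ h.symm, finPart_toAdelic]
  exact hγ

/-- The same for `γ` in the arithmetic subgroup `Γ(K_f) = U(J)(F) ∩ K_f` of level `K_f`. [cite: BorelJacquet1979, §4.1] -/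
theorem exists_toAdelic_eq_adelicSingle_mul_mem_awayLevel_of_mem_arithmeticLevel {γ : GL (Fin N) E}
    (hγ : γ ∈ arithmeticLevel F E c N J Kf) :
    ∃ k ∈ awayLevel F E c N J hc hfix w₁ Kf,
      toAdelic F E c N J ⟨γ, arithmeticLevel_le_rational Kf hγ⟩ =
        adelicSingle F E c N J hc hfix w₁
          (rationalToArchLocal F E c N J w₁ (hfix w₁.1) hc ⟨γ, arithmeticLevel_le_rational Kf hγ⟩) * k := by
  obtain ⟨hγr, hγK⟩ := mem_arithmeticLevel_iff.1 hγ
  exact exists_toAdelic_eq_adelicSingle_mul_mem_awayLevel F E c N J hc hfix w₁ Kf hγK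

/-! ### 1d. The special variant: determinant-one archimedean components -/

/-- **`g ↦ det ((g_∞)_w) ∈ ℂˣ`**, the determinant of the component at the complex place `w`. [folklore] -/
def archDetAt (w : {w : InfinitePlace E // IsComplex w}) : (adelicGroupData F E c N J).Adelic →* ℂˣ :=
  (Matrix.GeneralLinearGroup.det.comp (archLocal E N J w).subtype).comp
    ((archAt F E c N J w (hfix w.1) hc).comp (archPart F E c N J))

/-- Unfolding `archDetAt`. [folklore] -/
theorem archDetAt_apply (w : {w : InfinitePlace E // IsComplex w}) (g : (adelicGroupData F E c N J).Adelic) :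
    archDetAt F E c N J hc hfix w g =
      Matrix.GeneralLinearGroup.det ((archAt F E c N J w (hfix w.1) hc (archPart F E c N J g) : archLocal E N J w) :
        GL (Fin N) ℂ) := rfl

/-- **The special `K`-type subgroup away from `w₁` at finite level `K_f`**:
`specialAwayLevel w₁ K_f = {k ∈ awayLevel w₁ K_f | det ((k_∞)_w) = 1 for all w} = Π_{w ≠ w₁} SU(σ_w J)(ℂ) × K_f`.
[cite: BorelJacquet1979, §4.1] -/
def specialAwayLevel : Subgroup (adelicGroupData F E c N J).Adelic :=
  awayLevel F E c N J hc hfix w₁ Kf ⊓ ⨅ w, (archDetAt F E c N J hc hfix w).ker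

/-- Membership in `specialAwayLevel w₁ K_f`. [folklore] -/
theorem mem_specialAwayLevel_iff (k : (adelicGroupData F E c N J).Adelic) :
    k ∈ specialAwayLevel F E c N J hc hfix w₁ Kf ↔
      k ∈ awayLevel F E c N J hc hfix w₁ Kf ∧ ∀ w, archDetAt F E c N J hc hfix w k = 1 := by
  simp only [specialAwayLevel, Subgroup.mem_inf, Subgroup.mem_iInf, MonoidHom.mem_ker]

/-- `specialAwayLevel w₁ K_f ≤ awayLevel w₁ K_f`. [folklore] -/
theorem specialAwayLevel_le_awayLevel :
    specialAwayLevel F E c N J hc hfix w₁ Kf ≤ awayLevel F E c N J hc hfix w₁ Kf := inf_le_left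

/-- `specialAwayLevel w₁ K_f ≤ awayFrom w₁`. [folklore] -/
theorem specialAwayLevel_le_awayFrom :
    specialAwayLevel F E c N J hc hfix w₁ Kf ≤ awayFrom F E c N J hc hfix w₁ :=
  (specialAwayLevel_le_awayLevel F E c N J hc hfix w₁ Kf).trans (awayLevel_le_awayFrom F E c N J hc hfix w₁ Kf)

/-- `specialAwayLevel w₁` is monotone in the finite level. [folklore] -/
theorem specialAwayLevel_mono {Kf Kf' : Subgroup (finAdelic F E c N J)} (h : Kf ≤ Kf') :
    specialAwayLevel F E c N J hc hfix w₁ Kf ≤ specialAwayLevel F E c N J hc hfix w₁ Kf' :=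
  inf_le_inf_right _ (awayLevel_mono F E c N J hc hfix w₁ h)

/-- The finite-adelic factor meets `specialAwayLevel w₁ K_f` in `K_f`. [folklore] -/
theorem finAdelicToAdelic_mem_specialAwayLevel_iff (b : finAdelic F E c N J) :
    finAdelicToAdelic F E c N J b ∈ specialAwayLevel F E c N J hc hfix w₁ Kf ↔ b ∈ Kf := by
  rw [mem_specialAwayLevel_iff, finAdelicToAdelic_mem_awayLevel_iff, and_iff_left]
  intro w
  rw [archDetAt_apply, archPart_finAdelicToAdelic, map_one, OneMemClass.coe_one, map_one]

/-- Elements of `specialAwayLevel w₁ K_f` commute with the `w₁`-factor. [cite: BorelJacquet1979, §4.1] -/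
theorem commute_adelicSingle_of_mem_specialAwayLevel (u : archLocal E N J w₁) {k : (adelicGroupData F E c N J).Adelic}
    (hk : k ∈ specialAwayLevel F E c N J hc hfix w₁ Kf) : Commute k (adelicSingle F E c N J hc hfix w₁ u) :=
  commute_adelicSingle_of_mem_awayLevel F E c N J hc hfix w₁ Kf u hk.1

omit [NumberField F] [NumberField E] in
/-- `det (σ_w γ) = σ_w (det γ)`; in particular `det (σ_w γ) = 1` when `det γ = 1`. [folklore] -/
theorem det_rationalToArchLocal_eq_one {w : {w : InfinitePlace E // IsComplex w}} (hw : c • w.1 = w.1)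
    {γ : rational F E c N J} (hdet : Matrix.GeneralLinearGroup.det (γ : GL (Fin N) E) = 1) :
    Matrix.GeneralLinearGroup.det ((rationalToArchLocal F E c N J w hw hc γ : archLocal E N J w) : GL (Fin N) ℂ) = 1 := by
  rw [coe_rationalToArchLocal, Matrix.GeneralLinearGroup.map_det, hdet, map_one]

/-- **Rational splitting into the special `K`-type group**: for `γ ∈ U(J)(F)` with `γ_f ∈ K_f` and `det γ = 1`,
`γ = adelicSingle w₁ (σ_{w₁} γ) · k` with `k ∈ specialAwayLevel w₁ K_f` (`(k_∞)_w = σ_w γ` has determinant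
`σ_w (det γ) = 1` for `w ≠ w₁`, and `(k_∞)_{w₁} = 1`). [cite: BorelJacquet1979, §4.1] -/
theorem exists_toAdelic_eq_adelicSingle_mul_mem_specialAwayLevel {γ : rational F E c N J}
    (hγ : rationalToFinAdelic F E c N J γ ∈ Kf) (hdet : Matrix.GeneralLinearGroup.det (γ : GL (Fin N) E) = 1) :
    ∃ k ∈ specialAwayLevel F E c N J hc hfix w₁ Kf,
      toAdelic F E c N J γ = adelicSingle F E c N J hc hfix w₁ (rationalToArchLocal F E c N J w₁ (hfix w₁.1) hc γ) * k := by
  obtain ⟨k, hk, h⟩ := exists_toAdelic_eq_adelicSingle_mul_mem_awayLevel F E c N J hc hfix w₁ Kf hγ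
  have h₁ : archDetAt F E c N J hc hfix w₁ k = 1 := by
    rw [archDetAt_apply, (mem_awayFrom_iff F E c N J hc hfix w₁ k).1 hk.1, OneMemClass.coe_one, map_one]
  refine ⟨k, (mem_specialAwayLevel_iff F E c N J hc hfix w₁ Kf k).2 ⟨hk, fun w => ?_⟩, h⟩
  by_cases hw : w = w₁
  · rw [hw, h₁]
  · rw [archDetAt_apply, archAt_archPart_eq_of_adelicSingle_mul_eq F E c N J hc hfix w₁ hw h.symm, archPart_toAdelic,
      archAt_rationalToArch]
    exact det_rationalToArchLocal_eq_one F E c N J hc (hfix w.1) hdet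

/-- The same for `γ ∈ Γ(K_f)` with `det γ = 1`. [cite: BorelJacquet1979, §4.1] -/
theorem exists_toAdelic_eq_adelicSingle_mul_mem_specialAwayLevel_of_mem_arithmeticLevel {γ : GL (Fin N) E}
    (hγ : γ ∈ arithmeticLevel F E c N J Kf) (hdet : Matrix.GeneralLinearGroup.det γ = 1) :
    ∃ k ∈ specialAwayLevel F E c N J hc hfix w₁ Kf,
      toAdelic F E c N J ⟨γ, arithmeticLevel_le_rational Kf hγ⟩ =
        adelicSingle F E c N J hc hfix w₁
          (rationalToArchLocal F E c N J w₁ (hfix w₁.1) hc ⟨γ, arithmeticLevel_le_rational Kf hγ⟩) * k := by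
  obtain ⟨hγr, hγK⟩ := mem_arithmeticLevel_iff.1 hγ
  exact exists_toAdelic_eq_adelicSingle_mul_mem_specialAwayLevel F E c N J hc hfix w₁ Kf hγK hdet

/-! ### 1e. The one-place obstruction -/

/-- **The one-place obstruction.** If `adelicSingle w₁ u · k = γ` is a rational point and the corrector `k` has
trivial component at some complex place `w₂ ≠ w₁`, then `γ = 1`: comparing `w₂`-components gives `1 = σ_{w₂}(γ)`, and
`σ_{w₂}` is injective on `U(J)(F)`. (So the components `σ_w(γ)`, `w ≠ w₁`, of a corrector of a rational point
`γ ≠ 1` are all non-trivial: a `K`-type group absorbing `Γ` along the section at `w₁` must contain them.) [folklore] -/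
theorem eq_one_of_adelicSingle_mul_eq_toAdelic {w₂ : {w : InfinitePlace E // IsComplex w}} (hw : w₂ ≠ w₁)
    {u : archLocal E N J w₁} {k : (adelicGroupData F E c N J).Adelic} {γ : rational F E c N J}
    (hk : archAt F E c N J w₂ (hfix w₂.1) hc (archPart F E c N J k) = 1)
    (h : adelicSingle F E c N J hc hfix w₁ u * k = toAdelic F E c N J γ) : γ = 1 := by
  have h₂ := archAt_archPart_eq_of_adelicSingle_mul_eq F E c N J hc hfix w₁ hw h
  rw [hk, archPart_toAdelic, archAt_rationalToArch] at h₂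
  exact (rationalToArchLocal_injective F E c N J hc w₂ (hfix w₂.1) (h₂.symm.trans (map_one _).symm))

/-- The one-place obstruction, continued: if moreover `k ∈ awayFrom w₁`, then also `u = 1` and `k = 1`. [folklore] -/
theorem eq_one_of_adelicSingle_mul_eq_toAdelic' {w₂ : {w : InfinitePlace E // IsComplex w}} (hw : w₂ ≠ w₁)
    {u : archLocal E N J w₁} {k : (adelicGroupData F E c N J).Adelic} {γ : rational F E c N J}
    (hk₁ : k ∈ awayFrom F E c N J hc hfix w₁) (hk : archAt F E c N J w₂ (hfix w₂.1) hc (archPart F E c N J k) = 1)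
    (h : adelicSingle F E c N J hc hfix w₁ u * k = toAdelic F E c N J γ) : γ = 1 ∧ u = 1 ∧ k = 1 := by
  have hγ : γ = 1 := eq_one_of_adelicSingle_mul_eq_toAdelic F E c N J hc hfix w₁ hw hk h
  have h₁ : adelicSingle F E c N J hc hfix w₁ u * k = adelicSingle F E c N J hc hfix w₁ 1 * 1 := by
    rw [h, hγ, map_one, map_one, mul_one]
    rfl
  obtain ⟨hu, hk'⟩ := eq_of_adelicSingle_mul_eq_adelicSingle_mul F E c N J hc hfix w₁ hk₁ (one_mem _) h₁
  exact ⟨hγ, hu, hk'⟩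

/-- **The one-place obstruction for a finite-adelic corrector**: if `E` has a complex place other than `w₁` and
`adelicSingle w₁ u · k = γ` is rational with `k` in the finite-adelic factor `U(J)(𝔸_{F,f})` (`k_∞ = 1`), then
`γ = 1`, `u = 1`, `k = 1`. [folklore] -/
theorem eq_one_of_adelicSingle_mul_eq_toAdelic_of_archPart_eq_one
    (hw : ∃ w₂ : {w : InfinitePlace E // IsComplex w}, w₂ ≠ w₁)
    {u : archLocal E N J w₁} {k : (adelicGroupData F E c N J).Adelic} {γ : rational F E c N J}
    (hk : archPart F E c N J k = 1) (h : adelicSingle F E c N J hc hfix w₁ u * k = toAdelic F E c N J γ) :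
    γ = 1 ∧ u = 1 ∧ k = 1 := by
  obtain ⟨w₂, hw₂⟩ := hw
  refine eq_one_of_adelicSingle_mul_eq_toAdelic' F E c N J hc hfix w₁ hw₂
    (ker_archPart_le_awayFrom F E c N J hc hfix w₁ (MonoidHom.mem_ker.2 hk)) ?_ h
  rw [hk, map_one]

/-- The same with `k ∈ finiteAdelic` (`= ker archPart`, `ker_archPart`). [folklore] -/
theorem eq_one_of_adelicSingle_mul_eq_toAdelic_of_mem_finiteAdelic
    (hw : ∃ w₂ : {w : InfinitePlace E // IsComplex w}, w₂ ≠ w₁)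
    {u : archLocal E N J w₁} {k : (adelicGroupData F E c N J).Adelic} {γ : rational F E c N J}
    (hk : k ∈ finiteAdelic F E c N J) (h : adelicSingle F E c N J hc hfix w₁ u * k = toAdelic F E c N J γ) :
    γ = 1 ∧ u = 1 ∧ k = 1 := by
  rw [← ker_archPart] at hk
  exact eq_one_of_adelicSingle_mul_eq_toAdelic_of_archPart_eq_one F E c N J hc hfix w₁ hw (MonoidHom.mem_ker.1 hk) h

/-- **Corollary: a `K`-type group inside the finite-adelic factor absorbs no non-trivial rational point along the
section at `w₁`** (two complex places): if `k ∈ K ≤ finiteAdelic` and `adelicSingle w₁ u · k` is rational, then `u = 1`.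
[folklore] -/
theorem eq_one_of_adelicSingle_mul_mem_range_toAdelic (hw : ∃ w₂ : {w : InfinitePlace E // IsComplex w}, w₂ ≠ w₁)
    {K : Subgroup (adelicGroupData F E c N J).Adelic} (hK : K ≤ finiteAdelic F E c N J)
    {u : archLocal E N J w₁} {k : (adelicGroupData F E c N J).Adelic} (hk : k ∈ K)
    (h : adelicSingle F E c N J hc hfix w₁ u * k ∈ (toAdelic F E c N J).range) : u = 1 ∧ k = 1 := by
  obtain ⟨γ, hγ⟩ := h
  exact (eq_one_of_adelicSingle_mul_eq_toAdelic_of_mem_finiteAdelic F E c N J hc hfix w₁ hw (hK hk) hγ.symm).2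

end Single

/-! ## 2. `N = 3`: at a complex embedding through a frame, and the CM case -/

section Emb

variable (hc : c ≠ 1) (hfix : ∀ w : InfinitePlace E, c • w = w) (τ : E →+* ℂ) (hτ : IsComplex (InfinitePlace.mk τ))
  (J₃ : Matrix (Fin 3) (Fin 3) E) (T : GL (Fin 3) ℂ) (hT : formCongr (starRingEnd ℂ) T (J₃.map τ) = BallModel.J)
  (Kf : Subgroup (finAdelic F E c 3 J₃))

/-- **Elements of `awayLevel (mk τ) K_f` commute with the `U(2,1)`-section at `τ`.** [folklore] -/
theorem commute_archSectionU21Emb_of_mem_awayLevel (u : U21) {k : (adelicGroupData F E c 3 J₃).Adelic}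
    (hk : k ∈ awayLevel F E c 3 J₃ hc hfix (placeOf E τ hτ) Kf) :
    Commute k (archSectionU21Emb F E c hc hfix τ hτ J₃ T hT u) :=
  commute_archSectionU21Emb_of_mem_awayFrom F E c hc hfix τ hτ J₃ T hT u hk.1

/-- **Rational splitting through the frame at level `K_f`**: `γ = archSectionU21Emb τ T (T⁻¹ τ(γ) T) · k` with
`k ∈ awayLevel (mk τ) K_f`, for `γ ∈ U(J)(F)` with `γ_f ∈ K_f`. [cite: BorelJacquet1979, §4.1] -/
theorem exists_toAdelic_eq_archSectionU21Emb_mul_mem_awayLevel {γ : rational F E c 3 J₃}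
    (hγ : rationalToFinAdelic F E c 3 J₃ γ ∈ Kf) :
    ∃ k ∈ awayLevel F E c 3 J₃ hc hfix (placeOf E τ hτ) Kf,
      toAdelic F E c 3 J₃ γ =
        archSectionU21Emb F E c hc hfix τ hτ J₃ T hT
          (archProjU21Emb F E c J₃ τ hτ T hT (hfix _) hc (rationalToArch F E c 3 J₃ γ)) * k := by
  obtain ⟨k, hk, h⟩ := exists_eq_adelicSingle_mul_mem_awayLevel F E c 3 J₃ hc hfix (placeOf E τ hτ) Kf
    (g := toAdelic F E c 3 J₃ γ) (by rwa [finPart_toAdelic])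
  refine ⟨k, hk, ?_⟩
  rwa [archPart_toAdelic, archAt_rationalToArch_eq_archLocalOfEmb F E c hc hfix τ hτ J₃ T hT,
    ← archSectionU21Emb_apply] at h

/-- The special variant (`det γ = 1`, `k ∈ specialAwayLevel (mk τ) K_f`). [cite: BorelJacquet1979, §4.1] -/
theorem exists_toAdelic_eq_archSectionU21Emb_mul_mem_specialAwayLevel {γ : rational F E c 3 J₃}
    (hγ : rationalToFinAdelic F E c 3 J₃ γ ∈ Kf) (hdet : Matrix.GeneralLinearGroup.det (γ : GL (Fin 3) E) = 1) :
    ∃ k ∈ specialAwayLevel F E c 3 J₃ hc hfix (placeOf E τ hτ) Kf,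
      toAdelic F E c 3 J₃ γ =
        archSectionU21Emb F E c hc hfix τ hτ J₃ T hT
          (archProjU21Emb F E c J₃ τ hτ T hT (hfix _) hc (rationalToArch F E c 3 J₃ γ)) * k := by
  obtain ⟨k, hk, h⟩ := exists_toAdelic_eq_adelicSingle_mul_mem_specialAwayLevel F E c 3 J₃ hc hfix (placeOf E τ hτ) Kf
    hγ hdet
  refine ⟨k, hk, ?_⟩
  rwa [← archAt_rationalToArch, archAt_rationalToArch_eq_archLocalOfEmb F E c hc hfix τ hτ J₃ T hT,
    ← archSectionU21Emb_apply] at h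

/-- **The one-place obstruction in frame coordinates**: if `E` has a complex place other than `mk τ`, and
`archSectionU21Emb τ T δ · k = γ` is rational with `k_∞ = 1`, then `γ = 1`, `δ = 1` and `k = 1`. [folklore] -/
theorem eq_one_of_archSectionU21Emb_mul_eq_toAdelic
    (hw : ∃ w₂ : {w : InfinitePlace E // IsComplex w}, w₂ ≠ placeOf E τ hτ)
    {δ : U21} {k : (adelicGroupData F E c 3 J₃).Adelic} {γ : rational F E c 3 J₃}
    (hk : archPart F E c 3 J₃ k = 1) (h : archSectionU21Emb F E c hc hfix τ hτ J₃ T hT δ * k = toAdelic F E c 3 J₃ γ) :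
    γ = 1 ∧ δ = 1 ∧ k = 1 := by
  rw [archSectionU21Emb_apply] at h
  obtain ⟨hγ, hu, hk'⟩ :=
    eq_one_of_adelicSingle_mul_eq_toAdelic_of_archPart_eq_one F E c 3 J₃ hc hfix (placeOf E τ hτ) hw hk h
  refine ⟨hγ, ?_, hk'⟩
  have hu' := congrArg (formEquivU21 E J₃ τ T hT) ((archLocalOfEmb_injective E 3 J₃ τ hτ) (hu.trans (map_one _).symm))
  rwa [ContinuousMulEquiv.apply_symm_apply, map_one] at hu'

end Emb

section CM

variable (L : Type) [Field L] [NumberField L] [IsCMField L] (ι : L →+* ℂ) (H : Matrix (Fin N) (Fin N) L)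
  (Kf : Subgroup (finAdelic (↥(maximalRealSubfield L)) L (IsCMField.complexConj L) N H))

/-- **CM case: the `K`-type subgroup of `U(H)(𝔸_{L⁺})` away from the place of `ι` at finite level `K_f`**, typed on
`↥(adelicUnitaryGroup L H)`. [cite: BorelJacquet1979, §4.1] -/
def awayLevelCM : Subgroup ↥(adelicUnitaryGroup L H) :=
  awayLevel (↥(maximalRealSubfield L)) L (IsCMField.complexConj L) N H (IsCMField.complexConj_ne_one L)
    (complexConj_smul_infinitePlace L) (cmPlace L ι) Kf

/-- **CM case: the special `K`-type subgroup** (determinant-one archimedean components), typed on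
`↥(adelicUnitaryGroup L H)`. [cite: BorelJacquet1979, §4.1] -/
def specialAwayLevelCM : Subgroup ↥(adelicUnitaryGroup L H) :=
  specialAwayLevel (↥(maximalRealSubfield L)) L (IsCMField.complexConj L) N H (IsCMField.complexConj_ne_one L)
    (complexConj_smul_infinitePlace L) (cmPlace L ι) Kf

/-- `awayLevelCM K_f ≤ awayFromCM`. [folklore] -/
theorem awayLevelCM_le_awayFromCM : awayLevelCM N L ι H Kf ≤ awayFromCM N L ι H :=
  awayLevel_le_awayFrom _ _ _ _ _ _ _ _ _

/-- `specialAwayLevelCM K_f ≤ awayLevelCM K_f`. [folklore] -/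
theorem specialAwayLevelCM_le_awayLevelCM : specialAwayLevelCM N L ι H Kf ≤ awayLevelCM N L ι H Kf :=
  specialAwayLevel_le_awayLevel _ _ _ _ _ _ _ _ _

/-- Membership in `awayLevelCM K_f`: trivial component at the place of `ι` and finite part in `K_f`. [folklore] -/
theorem mem_awayLevelCM_iff (k : ↥(adelicUnitaryGroup L H)) :
    k ∈ awayLevelCM N L ι H Kf ↔
      k ∈ awayFromCM N L ι H ∧ finPart (↥(maximalRealSubfield L)) L (IsCMField.complexConj L) N H k ∈ Kf :=
  Iff.rfl

/-- A CM field of degree `> 2` has a complex place other than the place of `ι`. [folklore] -/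
theorem exists_ne_cmPlace (h : 2 < Module.finrank ℚ L) : ∃ w₂ : {w : InfinitePlace L // IsComplex w}, w₂ ≠ cmPlace L ι :=
  haveI := IsCMField.isTotallyComplex L
  exists_ne_of_two_lt_finrank L h (cmPlace L ι)

variable (H : Matrix (Fin 3) (Fin 3) L) (T : GL (Fin 3) ℂ)
  (hT : (T : Matrix (Fin 3) (Fin 3) ℂ)ᴴ * H.map ι * (T : Matrix (Fin 3) (Fin 3) ℂ) = BallModel.J)
  (Kf : Subgroup (finAdelic (↥(maximalRealSubfield L)) L (IsCMField.complexConj L) 3 H))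

/-- **CM case: `k ∈ awayLevelCM K_f → Commute k (archSectionU21CM u)`.** [folklore] -/
theorem commute_archSectionU21CM_of_mem_awayLevelCM (u : U21) {k : ↥(adelicUnitaryGroup L H)}
    (hk : k ∈ awayLevelCM 3 L ι H Kf) : Commute k (archSectionU21CM L ι H T hT u) :=
  commute_archSectionU21CM_of_mem_awayFromCM L ι H T hT u hk.1

/-- **CM case: `k ∈ specialAwayLevelCM K_f → Commute k (archSectionU21CM u)`.** [folklore] -/
theorem commute_archSectionU21CM_of_mem_specialAwayLevelCM (u : U21) {k : ↥(adelicUnitaryGroup L H)}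
    (hk : k ∈ specialAwayLevelCM 3 L ι H Kf) : Commute k (archSectionU21CM L ι H T hT u) :=
  commute_archSectionU21CM_of_mem_awayFromCM L ι H T hT u hk.1.1

/-- **CM case, rational splitting at level `K_f`: `∃ k ∈ awayLevelCM K_f, archSectionU21CM (toBall g) · k ∈ U(H)(L⁺)`**
for every `g ∈ U(H)(L⁺)` with `g_f ∈ K_f`. [cite: BorelJacquet1979, §4.1] -/
theorem exists_archSectionU21CM_mul_mem_adelicUnitaryRat_of_mem
    (g : unitaryGroup (IsCMField.complexConj L : L →+* L) H)
    (hg : rationalToFinAdelic (↥(maximalRealSubfield L)) L (IsCMField.complexConj L) 3 H (ballRational L H g) ∈ Kf) :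
    ∃ k ∈ awayLevelCM 3 L ι H Kf,
      archSectionU21CM L ι H T hT (BallRational.toBall L ι H T hT g) * k ∈ adelicUnitaryRat L H := by
  obtain ⟨k, hk, h⟩ := exists_toAdelic_eq_archSectionU21Emb_mul_mem_awayLevel (↥(maximalRealSubfield L)) L
    (IsCMField.complexConj L) (IsCMField.complexConj_ne_one L) (complexConj_smul_infinitePlace L) ι
    (isComplex_mk_of_isCMField L ι) H T (formCongr_eq_of_conjTranspose L ι H T hT) Kf hg
  refine ⟨k, hk, ?_⟩
  have h' : archSectionU21Emb (↥(maximalRealSubfield L)) L (IsCMField.complexConj L) (IsCMField.complexConj_ne_one L)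
        (complexConj_smul_infinitePlace L) ι (isComplex_mk_of_isCMField L ι) H T
        (formCongr_eq_of_conjTranspose L ι H T hT) (BallRational.toBall L ι H T hT g) * k =
      toAdelic (↥(maximalRealSubfield L)) L (IsCMField.complexConj L) 3 H (ballRational L H g) :=
    (congrArg (fun u => archSectionU21Emb (↥(maximalRealSubfield L)) L (IsCMField.complexConj L)
        (IsCMField.complexConj_ne_one L) (complexConj_smul_infinitePlace L) ι (isComplex_mk_of_isCMField L ι) H T
        (formCongr_eq_of_conjTranspose L ι H T hT) u * k) (toBall_eq_archProjU21EmbCM L ι H T hT g)).trans h.symm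
  refine (mem_adelicUnitaryRat_iff L H _).2 ⟨g, g.2, ?_⟩
  exact congrArg Subtype.val h'.symm

/-- The same for `g` in the arithmetic subgroup `Γ(K_f)` (as a subgroup of `GL₃(L)`). [cite: BorelJacquet1979, §4.1] -/
theorem exists_archSectionU21CM_mul_mem_adelicUnitaryRat_of_mem_arithmeticLevel
    (g : unitaryGroup (IsCMField.complexConj L : L →+* L) H)
    (hg : (g : GL (Fin 3) L) ∈ arithmeticLevel (↥(maximalRealSubfield L)) L (IsCMField.complexConj L) 3 H Kf) :
    ∃ k ∈ awayLevelCM 3 L ι H Kf,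
      archSectionU21CM L ι H T hT (BallRational.toBall L ι H T hT g) * k ∈ adelicUnitaryRat L H := by
  obtain ⟨hgr, hgK⟩ := mem_arithmeticLevel_iff.1 hg
  exact exists_archSectionU21CM_mul_mem_adelicUnitaryRat_of_mem L ι H T hT Kf g hgK

/-- **CM case, special variant**: for `g ∈ U(H)(L⁺)` with `g_f ∈ K_f` and `det g = 1`,
`∃ k ∈ specialAwayLevelCM K_f, archSectionU21CM (toBall g) · k ∈ U(H)(L⁺)`. [cite: BorelJacquet1979, §4.1] -/
theorem exists_archSectionU21CM_mul_mem_adelicUnitaryRat_of_mem_of_det_eq_one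
    (g : unitaryGroup (IsCMField.complexConj L : L →+* L) H)
    (hg : rationalToFinAdelic (↥(maximalRealSubfield L)) L (IsCMField.complexConj L) 3 H (ballRational L H g) ∈ Kf)
    (hdet : Matrix.GeneralLinearGroup.det (g : GL (Fin 3) L) = 1) :
    ∃ k ∈ specialAwayLevelCM 3 L ι H Kf,
      archSectionU21CM L ι H T hT (BallRational.toBall L ι H T hT g) * k ∈ adelicUnitaryRat L H := by
  obtain ⟨k, hk, h⟩ := exists_toAdelic_eq_archSectionU21Emb_mul_mem_specialAwayLevel (↥(maximalRealSubfield L)) L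
    (IsCMField.complexConj L) (IsCMField.complexConj_ne_one L) (complexConj_smul_infinitePlace L) ι
    (isComplex_mk_of_isCMField L ι) H T (formCongr_eq_of_conjTranspose L ι H T hT) Kf hg hdet
  refine ⟨k, hk, ?_⟩
  have h' : archSectionU21Emb (↥(maximalRealSubfield L)) L (IsCMField.complexConj L) (IsCMField.complexConj_ne_one L)
        (complexConj_smul_infinitePlace L) ι (isComplex_mk_of_isCMField L ι) H T
        (formCongr_eq_of_conjTranspose L ι H T hT) (BallRational.toBall L ι H T hT g) * k =
      toAdelic (↥(maximalRealSubfield L)) L (IsCMField.complexConj L) 3 H (ballRational L H g) :=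
    (congrArg (fun u => archSectionU21Emb (↥(maximalRealSubfield L)) L (IsCMField.complexConj L)
        (IsCMField.complexConj_ne_one L) (complexConj_smul_infinitePlace L) ι (isComplex_mk_of_isCMField L ι) H T
        (formCongr_eq_of_conjTranspose L ι H T hT) u * k) (toBall_eq_archProjU21EmbCM L ι H T hT g)).trans h.symm
  refine (mem_adelicUnitaryRat_iff L H _).2 ⟨g, g.2, ?_⟩
  exact congrArg Subtype.val h'.symm

/-- **CM case, the one-place obstruction**: if `[L : ℚ] > 2` (i.e. `[L⁺ : ℚ] ≥ 2`) and `archSectionU21CM δ · k` is a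
rational point of `U(H)(𝔸_{L⁺})` for some `δ ∈ U(2,1)` and some `k` with trivial archimedean part (`k` in the
finite-adelic factor), then `δ = 1` and `k = 1`. Hence a `K`-type group contained in `U(H)(𝔸_{L⁺,f})` can absorb no
non-trivial element of an arithmetic lattice `Δ ≤ U(2,1)` along the honest one-place section. [folklore] -/
theorem eq_one_of_archSectionU21CM_mul_mem_adelicUnitaryRat (h2 : 2 < Module.finrank ℚ L) {δ : U21}
    {k : ↥(adelicUnitaryGroup L H)}
    (hk : archPart (↥(maximalRealSubfield L)) L (IsCMField.complexConj L) 3 H k = 1)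
    (h : archSectionU21CM L ι H T hT δ * k ∈ adelicUnitaryRat L H) : δ = 1 ∧ k = 1 := by
  obtain ⟨g, hg, hgk⟩ := (mem_adelicUnitaryRat_iff L H _).1 h
  refine (eq_one_of_archSectionU21Emb_mul_eq_toAdelic (↥(maximalRealSubfield L)) L (IsCMField.complexConj L)
    (IsCMField.complexConj_ne_one L) (complexConj_smul_infinitePlace L) ι (isComplex_mk_of_isCMField L ι) H T
    (formCongr_eq_of_conjTranspose L ι H T hT) (exists_ne_cmPlace L ι h2) (δ := δ) (k := k)
    (γ := ballRational L H ⟨g, hg⟩) hk ?_).2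
  refine Subtype.ext ?_
  exact hgk.symm

/-- The same read on `toBall`: if `archSectionU21CM (toBall g) · k ∈ U(H)(L⁺)` with `k_∞ = 1` and `[L : ℚ] > 2`, then
`toBall g = 1` (and `k = 1`). [folklore] -/
theorem toBall_eq_one_of_archSectionU21CM_mul_mem_adelicUnitaryRat (h2 : 2 < Module.finrank ℚ L)
    (g : unitaryGroup (IsCMField.complexConj L : L →+* L) H) {k : ↥(adelicUnitaryGroup L H)}
    (hk : archPart (↥(maximalRealSubfield L)) L (IsCMField.complexConj L) 3 H k = 1)
    (h : archSectionU21CM L ι H T hT (BallRational.toBall L ι H T hT g) * k ∈ adelicUnitaryRat L H) :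
    BallRational.toBall L ι H T hT g = 1 ∧ k = 1 :=
  eq_one_of_archSectionU21CM_mul_mem_adelicUnitaryRat L ι H T hT h2 hk h

end CM

end UnitaryGroup

end Literature.NumberTheory.Automorphic

end
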